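import Literature.NumberTheory.Rogawski1990.GlobalAPacketMembership                       -- ★ D6: `OneDimAutRepH.splitν₀`, `locη`, `locψ`
import Literature.NumberTheory.Rogawski1990.UnitaryGroupGeometricPointsCM                  -- ★ `algEquiv_eq_one_or_eq_complexConj`
import Literature.RepresentationTheory.HarrisKudlaSweet1996.SplittingCharactersCM           -- ★ `unitaryClassChar`, `IsSplittingChar.isConjugateSymplectic`
import Literature.NumberTheory.Automorphic.Liu2021.FinAdelicCheckDescent                     -- ★ p817794 (B-p12 (g22)): U1-DESCENT `existsUnique_comp_finAdelicCheck`
import Literature.NumberTheory.Automorphic.Liu2021.LemD1SplitPlaceHeckeEigenvaluesJunction   -- ★ `Def411WeilCarriers.complexConj_mul_complexConj'`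
import Literature.NumberTheory.GaloisRepresentations.GlobalNormIndexIdelic                   -- ★ Galois descent `IdeleHerbrand.exists_ideleBaseChange_eq_of_forall_smul_eq`
import Literature.NumberTheory.Automorphic.ClassFieldCharacter                               -- ★ `AdeleRing.coe_smul_units`
import Summits.HodgeConjecture.HodgeConjecture.Theorems.F0P2iGRDLocality                     -- ★ p817805 (F0P2-p02 (g4)): `forall_localComponent_eq_of_semilocalComponent_eq`
import HarnessLib

/-!
# PKΠ rung 4 — the Gelbart–Rogawski dictionary pair `(μ_ξ, χ_f)` (DICT-CHOICE protocol): the witness and the split identities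

Crux `H413` (item `stmt-HodgeConjecture-24833`), sub-line `Cruxes/H413/Lines/F0_P2PKPiRung4.lean` v1.1, stub `stub_GRD`
(`StubGRD : ∃ μ₀ (conjugate-symplectic) χf (continuous, unitary), ∀ μ ~ μ₀ semi-locally, GRDMatrix … ξ μω hμu μ hμ χf`).

THE CHOICE (F0P2-plan (g6) DICT-CHOICE protocol 2026-08-31; in print `μ₀ = μ_ξ`, «`φ = μ η̃`, `η̃(a) = η(a/ā)`»
[Rogawski1990 §13.3 p. 195], [GelbartRogawski1991 (5.1.1)], and `χ_f` = the central character of `Π(ξ)_f`), in the tree's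
normalisations (`locη = (bcη)_w⁻¹`, `locψ = (bcψ)_w⁻¹`, `splitν₀ = locη · locψ · μω_w`, ★ D6 `GlobalAPacketMembership`):
* `grdHecke ξ μω := ξ.bcη⁻¹ * ξ.bcψ⁻¹ * μω` — the Hecke character `μ̃ = η̃⁻¹ ψ̃⁻¹ μω` of `L`; `grdMu` its circle-valued idèle CLASS
  character (★ `unitaryClassChar`); `toHeckeCharacter L (grdMu …) = grdHecke …`; it is CONJUGATE SYMPLECTIC (`η̃, ψ̃` vanish on
  `𝕀_{L⁺}`, `μω|_{𝕀_{L⁺}} = ω`) and its local component at every finite `w` is `splitν₀ ξ μω w` (Dν);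
* `grdNu ξ μω := (ξ.bcψ⁻¹ * (ξ.bcη⁻¹ * ξ.bcψ⁻¹ * μω) ^ 2)_f` — the finite part of `ψ̃⁻¹ μ̃²`; it KILLS the `c`-fixed finite idèles
  (Galois descent ★ `exists_ideleBaseChange_eq_of_forall_smul_eq` + `ω² = 1`), so it DESCENDS through `u ↦ u/ū` (★ p817794
  U1-DESCENT): `grdChi ξ μω hquad : U(1)(𝔸_{L⁺,f}) →* ℂˣ`, `grdChi ∘ finAdelicCheck = grdNu`, continuous and unitary.

THE SPLIT IDENTITIES from the two PINS of the rung-4 print rows (U′-N letter `GR91Lemma512NonsplitAsPrinted`, tokens identical):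
  `hμξ : ∀ v, (toHeckeCharacter L μ).semilocalComponent L v = (ξ.bcη⁻¹ * ξ.bcψ⁻¹ * μω).semilocalComponent L v`,
  `hχξ : ∀ z, χf (finAdelicCheck L⁺ L c̄ _ z) = (ξ.bcψ⁻¹ * (ξ.bcη⁻¹ * ξ.bcψ⁻¹ * μω) ^ 2) (Units.map (MonoidHom.inr …) z)`
⟹ at every place `w` of `L` over a finite `v` of `L⁺` (★ p817805 locality `semilocal ⇒ local`):
  (Dν) `ξ.splitν₀ μω w = (toHeckeCharacter L μ).localComponent w`,
  (Dψ) `ξ.locψ w = ((χf ∘ finAdelicCheck) ∘ single_w) * ((toHeckeCharacter L μ).localComponent w) ^ (1 - 3)`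
(`splitNu0_eq_localComponent_of_pin`, `locPsi_eq_wReading_mul_zpow_of_pins`) — exactly the hypotheses `hν`, `hψ` of ★ p817998
`F0P2iGRDSplit.grdMatrix_split_of_dictionary` (conjunct (S) of `GRDMatrix … ξ μω hμu μ hμ χf` for EVERY pair satisfying the pins is
then one `exact`), and the pins hold for `(grdMu, grdChi)` (`semilocalComponent_toHeckeCharacter_grdMu`, `grdChi_finAdelicCheck`).

[cite: Rogawski1990, §13.3 p. 195; §12.2 (2) p. 174; Lemma 4.13.1 (b) p. 62] [cite: GelbartRogawski1991, §5.1 (5.1.1), Lem 5.1.2 p. 466]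
[cite: Liu2021, Def. 4.1; Def. 4.11 (l. 2090–2096); App. D §D.1 (l. 5224)] [cite: CasselsFrohlichANT1967, Ch. VII §7.3 Prop. (a)]
-/

set_option autoImplicit false
set_option linter.dupNamespace false

noncomputable section

open NumberField IsDedekindDomain
open scoped Matrix
open Literature.NumberTheory Literature.NumberTheory.Automorphic Literature.NumberTheory.Automorphic.UnitaryGroup
open Literature.NumberTheory.Automorphic.IdeleClassGroup
open Literature.NumberTheory.Automorphic.Liu2021 Literature.NumberTheory.Automorphic.Liu2021.Def411WeilCarriers
open Literature.NumberTheory.GaloisRepresentations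
open Literature.RepresentationTheory.HarrisKudlaSweet1996
open Literature.NumberTheory.Rogawski1990

namespace Summit.HodgeConjecture.HodgeConjecture.Cruxes.H413.F0P2iGRDWitness

variable (L : Type) [Field L] [NumberField L] [IsCMField L]

/-! ## §1 The Hecke character `μ̃ = η̃⁻¹ ψ̃⁻¹ μω` and its class character `grdMu` -/

/-- **`μ̃_ξ := η̃⁻¹ · ψ̃⁻¹ · μω`**, a Hecke character of `L` (`η̃ = ξ.bcη`, `ψ̃ = ξ.bcψ` the base changes of ★ D5). Its local component at a
place `w` split over `L⁺` is the `GL₂`-block label `splitν₀ ξ μω w` of the split member (`localComponent_grdHecke`).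
[cite: Rogawski1990, §13.3 p. 195; Lemma 4.13.1 (b) p. 62] -/
def grdHecke (ξ : OneDimAutRepH L) (μω : HeckeCharacter L) : HeckeCharacter L :=
  ξ.bcη⁻¹ * ξ.bcψ⁻¹ * μω

/-- Unfolding `grdHecke`. [cite: Rogawski1990, §13.3 p. 195] -/
theorem grdHecke_def (ξ : OneDimAutRepH L) (μω : HeckeCharacter L) : grdHecke L ξ μω = ξ.bcη⁻¹ * ξ.bcψ⁻¹ * μω := rfl

/-- `μ̃` is unitary when `μω` is (★ `isUnitary_bcη`, ★ `isUnitary_bcψ`). [cite: Godement1964, §5 Thm. 4] -/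
theorem isUnitary_grdHecke (ξ : OneDimAutRepH L) {μω : HeckeCharacter L} (hμu : μω.IsUnitary) : (grdHecke L ξ μω).IsUnitary :=
  (ξ.isUnitary_bcη.inv.mul ξ.isUnitary_bcψ.inv).mul hμu

/-- **(Dν) for `μ̃`: the local component of `μ̃` at `w` is `splitν₀ ξ μω w = η_w ψ_w μω_w`** (all three readings are pointwise inverses ∕
products of local components — definitional). [cite: Rogawski1990, Lemma 4.13.1 (b) p. 62; §12.2 (2) p. 174] -/
theorem localComponent_grdHecke (ξ : OneDimAutRepH L) (μω : HeckeCharacter L) (w : HeightOneSpectrum (𝓞 L)) :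
    (grdHecke L ξ μω).localComponent w = ξ.splitν₀ μω w :=
  MonoidHom.ext fun _ => rfl

/-- The same for the printed token `ξ.bcη⁻¹ * ξ.bcψ⁻¹ * μω`. [cite: Rogawski1990, Lemma 4.13.1 (b) p. 62] -/
theorem localComponent_bcEtaInv_mul_bcPsiInv_mul (ξ : OneDimAutRepH L) (μω : HeckeCharacter L) (w : HeightOneSpectrum (𝓞 L)) :
    (ξ.bcη⁻¹ * ξ.bcψ⁻¹ * μω).localComponent w = ξ.splitν₀ μω w :=
  MonoidHom.ext fun _ => rfl

/-- `μ̃|_{𝕀_{L⁺}} = ω_{L/L⁺}`: `μ̃` is a splitting character for `m = 1` as soon as `μω|_{𝕀_{L⁺}} = ω` (`η̃`, `ψ̃` vanish on `𝕀_{L⁺}`,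
★ `bcη_ideleBaseChange`, ★ `bcψ_ideleBaseChange`). [cite: HarrisKudlaSweet1996, (1.5) p. 951] [cite: Rogawski1990, §12.2 p. 174] -/
theorem isSplittingChar_grdHecke (ξ : OneDimAutRepH L) (μω : HeckeCharacter L)
    (hquad : ∀ x : Literature.NumberTheory.GaloisRepresentations.ideleGroup ↥(maximalRealSubfield L),
      μω (AdeleRing.ideleBaseChange (↥(maximalRealSubfield L)) L x) = quadraticHeckeCharCM L x) :
    IsSplittingChar L 1 (grdHecke L ξ μω) := fun x => by
  rw [grdHecke_def, HeckeCharacter.mul_apply, HeckeCharacter.mul_apply, HeckeCharacter.inv_apply, HeckeCharacter.inv_apply,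
    ξ.bcη_ideleBaseChange, ξ.bcψ_ideleBaseChange, hquad, inv_one, one_mul, one_mul, pow_one]

/-- **`μ_ξ` — the conjugate-symplectic class character of the dictionary**: `μ̃` as a circle-valued character of `C_L`
(★ `unitaryClassChar`). [cite: Rogawski1990, §13.3 p. 195] [cite: GelbartRogawski1991, §5.1 (5.1.1)] -/
def grdMu (ξ : OneDimAutRepH L) (μω : HeckeCharacter L) (hμu : μω.IsUnitary) :
    Literature.NumberTheory.Automorphic.IdeleClassGroup L →ₜ* Circle :=
  unitaryClassChar L (grdHecke L ξ μω) (isUnitary_grdHecke L ξ hμu)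

/-- `toHeckeCharacter (grdMu …) = μ̃` (★ `toHeckeCharacter_unitaryClassChar`). [cite: WeilBNT1967, Ch. VII §3] -/
theorem toHeckeCharacter_grdMu (ξ : OneDimAutRepH L) (μω : HeckeCharacter L) (hμu : μω.IsUnitary) :
    toHeckeCharacter L (grdMu L ξ μω hμu) = ξ.bcη⁻¹ * ξ.bcψ⁻¹ * μω :=
  toHeckeCharacter_unitaryClassChar L _ _

/-- **`μ_ξ` is CONJUGATE SYMPLECTIC** (`μ_ξ|_{C_{L⁺}} = ω`; ★ `IsSplittingChar.isConjugateSymplectic` for odd `m = 1`). [cite: Liu2021, Def. 4.1]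
[cite: Rogawski1990, §13.3 p. 195] -/
theorem isConjugateSymplectic_grdMu (ξ : OneDimAutRepH L) (μω : HeckeCharacter L) (hμu : μω.IsUnitary)
    (hquad : ∀ x : Literature.NumberTheory.GaloisRepresentations.ideleGroup ↥(maximalRealSubfield L),
      μω (AdeleRing.ideleBaseChange (↥(maximalRealSubfield L)) L x) = quadraticHeckeCharCM L x) :
    IsConjugateSymplectic L (grdMu L ξ μω hμu) :=
  IsSplittingChar.isConjugateSymplectic odd_one (isUnitary_grdHecke L ξ hμu) (isSplittingChar_grdHecke L ξ μω hquad)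

/-- **The semi-local pin `hμξ` holds for `μ_ξ`** (token shape of the rung-4 print rows). [cite: Rogawski1990, §13.3 p. 195] -/
theorem semilocalComponent_toHeckeCharacter_grdMu (ξ : OneDimAutRepH L) (μω : HeckeCharacter L) (hμu : μω.IsUnitary)
    (v : HeightOneSpectrum (𝓞 ↥(maximalRealSubfield L))) :
    (toHeckeCharacter L (grdMu L ξ μω hμu)).semilocalComponent L v = (ξ.bcη⁻¹ * ξ.bcψ⁻¹ * μω).semilocalComponent L v := by
  rw [toHeckeCharacter_grdMu]

/-! ## §2 The finite idelic character `ν_ξ = (ψ̃⁻¹ μ̃²)_f` and its descent `χ_f` to `U(1)(𝔸_{L⁺,f})` -/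

/-- **`ν_ξ := (ψ̃⁻¹ · μ̃²)_f`**: the Hecke character `ξ.bcψ⁻¹ * (ξ.bcη⁻¹ * ξ.bcψ⁻¹ * μω) ^ 2` of `L` restricted to the FINITE idèles
`z ↦ (1_∞, z)` (`Units.map (MonoidHom.inr …)`, the token of the rung-4 print rows). [cite: Liu2021, App. D §D.1 (l. 5224)]
[cite: GelbartRogawski1991, §5.1 (5.1.1)] -/
def grdNu (ξ : OneDimAutRepH L) (μω : HeckeCharacter L) : (FiniteAdeleRing (𝓞 L) L)ˣ →* ℂˣ :=
  (ξ.bcψ⁻¹ * (ξ.bcη⁻¹ * ξ.bcψ⁻¹ * μω) ^ 2).toContinuousMonoidHom.toMonoidHom.comp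
    (Units.map (N := AdeleRing (𝓞 L) L) (MonoidHom.inr (InfiniteAdeleRing L) (FiniteAdeleRing (𝓞 L) L)))

/-- Unfolding `grdNu` (the printed token). [cite: Liu2021, App. D §D.1 (l. 5224)] -/
theorem grdNu_apply (ξ : OneDimAutRepH L) (μω : HeckeCharacter L) (z : (FiniteAdeleRing (𝓞 L) L)ˣ) :
    grdNu L ξ μω z = (ξ.bcψ⁻¹ * (ξ.bcη⁻¹ * ξ.bcψ⁻¹ * μω) ^ 2)
      (Units.map (N := AdeleRing (𝓞 L) L) (MonoidHom.inr (InfiniteAdeleRing L) (FiniteAdeleRing (𝓞 L) L)) z) := rfl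

/-- `ν_ξ` is continuous. [cite: TateThesis1967, §4.3] -/
theorem continuous_grdNu (ξ : OneDimAutRepH L) (μω : HeckeCharacter L) : Continuous (grdNu L ξ μω) :=
  (ξ.bcψ⁻¹ * (ξ.bcη⁻¹ * ξ.bcψ⁻¹ * μω) ^ 2).toContinuousMonoidHom.continuous.comp (Continuous.units_map _ (continuous_const.prodMk continuous_id))

/-- `ν_ξ` is unitary when `μω` is. [cite: Godement1964, §5 Thm. 4] -/
theorem norm_grdNu_apply (ξ : OneDimAutRepH L) {μω : HeckeCharacter L} (hμu : μω.IsUnitary) (z : (FiniteAdeleRing (𝓞 L) L)ˣ) :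
    ‖((grdNu L ξ μω z : ℂˣ) : ℂ)‖ = 1 := by
  rw [grdNu_apply, pow_two]
  exact (ξ.isUnitary_bcψ.inv.mul ((isUnitary_grdHecke L ξ hμu).mul (isUnitary_grdHecke L ξ hμu))) _

/-- The `w`-reading of `ν_ξ` is the local component of `ψ̃⁻¹ μ̃²` at `w` (`(1_∞, single_w u) = ι_w u`, definitional).
[cite: TateThesis1967, §3.2] -/
theorem grdNu_comp_unitsMap_finiteAdeleSingle (ξ : OneDimAutRepH L) (μω : HeckeCharacter L) (w : HeightOneSpectrum (𝓞 L)) :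
    (grdNu L ξ μω).comp (Units.map (finiteAdeleSingle w)) = (ξ.bcψ⁻¹ * (ξ.bcη⁻¹ * ξ.bcψ⁻¹ * μω) ^ 2).localComponent w :=
  MonoidHom.ext fun _ => rfl

/-- **`ν_ξ` KILLS THE `c`-FIXED FINITE IDÈLES** (the kernel of `u ↦ u/ū`): a `c`-fixed finite idèle `u` gives a `Gal(L/L⁺)`-fixed idèle
`(1_∞, u)` (`Gal = {1, c}`, ★ `algEquiv_eq_one_or_eq_complexConj`), which is a base change `x_L` (Galois descent ★
`IdeleHerbrand.exists_ideleBaseChange_eq_of_forall_smul_eq`); there `η̃ = ψ̃ = 1` and `μω = ω`, so `ν_ξ(u) = ω(x)² = 1`.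
[cite: CasselsFrohlichANT1967, Ch. VII §7.3 Prop. (a)] [cite: Liu2021, Def. 4.1] -/
theorem grdNu_eq_one_of_smul_eq (ξ : OneDimAutRepH L) (μω : HeckeCharacter L)
    (hquad : ∀ x : Literature.NumberTheory.GaloisRepresentations.ideleGroup ↥(maximalRealSubfield L),
      μω (AdeleRing.ideleBaseChange (↥(maximalRealSubfield L)) L x) = quadraticHeckeCharCM L x)
    (u : (FiniteAdeleRing (𝓞 L) L)ˣ) (hu : IsCMField.complexConj L • (u : FiniteAdeleRing (𝓞 L) L) = u) :
    grdNu L ξ μω u = 1 := by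
  set x : Literature.NumberTheory.GaloisRepresentations.ideleGroup L := Units.map (N := AdeleRing (𝓞 L) L) (MonoidHom.inr (InfiniteAdeleRing L) (FiniteAdeleRing (𝓞 L) L)) u
    with hx
  have hfix : ∀ σ : L ≃ₐ[↥(maximalRealSubfield L)] L, σ • x = x := by
    intro σ
    rcases algEquiv_eq_one_or_eq_complexConj L σ with rfl | rfl
    · exact one_smul _ _
    · refine Units.ext ?_
      rw [AdeleRing.coe_smul_units]
      refine Prod.ext ?_ ?_
      · rw [Literature.NumberTheory.Automorphic.AdeleRing.smul_fst]
        exact smul_one _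
      · rw [Literature.NumberTheory.Automorphic.AdeleRing.smul_snd]
        exact hu
  obtain ⟨y, hy⟩ := IdeleHerbrand.exists_ideleBaseChange_eq_of_forall_smul_eq x hfix
  rw [grdNu_apply, ← hx, ← hy, HeckeCharacter.mul_apply, HeckeCharacter.pow_apply, HeckeCharacter.mul_apply, HeckeCharacter.mul_apply,
    HeckeCharacter.inv_apply, HeckeCharacter.inv_apply, ξ.bcη_ideleBaseChange, ξ.bcψ_ideleBaseChange, hquad]
  simp only [inv_one, one_mul, quadraticHeckeCharCM_apply_sq]

/-- **`χ_f` — the `U(1)(𝔸_{L⁺,f})`-character of the dictionary**: the DESCENT of `ν_ξ` through `u ↦ u/ū` (★ p817794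
`existsUnique_comp_finAdelicCheck`; the involution proof is the one the (S)-closer ★ p817998 spells, any other is definitionally equal).
[cite: Liu2021, Def. 4.11 (l. 2090–2096); App. D §D.1 (l. 5224)] [cite: CasselsFrohlichANT1967, Ch. VII §7.3 Prop. (a)] -/
def grdChi (ξ : OneDimAutRepH L) (μω : HeckeCharacter L)
    (hquad : ∀ x : Literature.NumberTheory.GaloisRepresentations.ideleGroup ↥(maximalRealSubfield L),
      μω (AdeleRing.ideleBaseChange (↥(maximalRealSubfield L)) L x) = quadraticHeckeCharCM L x) :
    UnitaryGroup.finAdelicOne (↥(maximalRealSubfield L)) L (IsCMField.complexConj L) →* ℂˣ :=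
  (existsUnique_comp_finAdelicCheck (↥(maximalRealSubfield L)) L (IsCMField.complexConj L) (complexConj_mul_complexConj' L)
    (IsCMField.complexConj_ne_one L) (grdNu L ξ μω) (grdNu_eq_one_of_smul_eq L ξ μω hquad)).exists.choose

/-- The defining identity `χ_f ∘ (u ↦ u/ū) = ν_ξ`. [cite: Liu2021, App. D §D.1 (l. 5224)] -/
theorem grdChi_comp_finAdelicCheck (ξ : OneDimAutRepH L) (μω : HeckeCharacter L)
    (hquad : ∀ x : Literature.NumberTheory.GaloisRepresentations.ideleGroup ↥(maximalRealSubfield L),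
      μω (AdeleRing.ideleBaseChange (↥(maximalRealSubfield L)) L x) = quadraticHeckeCharCM L x)
    (hcc : IsCMField.complexConj L * IsCMField.complexConj L = 1) :
    (grdChi L ξ μω hquad).comp (finAdelicCheck (↥(maximalRealSubfield L)) L (IsCMField.complexConj L) hcc) = grdNu L ξ μω :=
  (existsUnique_comp_finAdelicCheck (↥(maximalRealSubfield L)) L (IsCMField.complexConj L) (complexConj_mul_complexConj' L)
    (IsCMField.complexConj_ne_one L) (grdNu L ξ μω) (grdNu_eq_one_of_smul_eq L ξ μω hquad)).exists.choose_spec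

/-- **The finite pin `hχξ` holds for `χ_f`** (token shape of the rung-4 print rows): `χ_f(z/z̄) = (ψ̃⁻¹ · (η̃⁻¹ ψ̃⁻¹ μω)²)((1_∞, z))`.
[cite: GelbartRogawski1991, §5.1 (5.1.1)] [cite: Liu2021, App. D §D.1 (l. 5224)] -/
theorem grdChi_finAdelicCheck (ξ : OneDimAutRepH L) (μω : HeckeCharacter L)
    (hquad : ∀ x : Literature.NumberTheory.GaloisRepresentations.ideleGroup ↥(maximalRealSubfield L),
      μω (AdeleRing.ideleBaseChange (↥(maximalRealSubfield L)) L x) = quadraticHeckeCharCM L x)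
    (hcc : IsCMField.complexConj L * IsCMField.complexConj L = 1) (z : (FiniteAdeleRing (𝓞 L) L)ˣ) :
    grdChi L ξ μω hquad (finAdelicCheck (↥(maximalRealSubfield L)) L (IsCMField.complexConj L) hcc z) =
      (ξ.bcψ⁻¹ * (ξ.bcη⁻¹ * ξ.bcψ⁻¹ * μω) ^ 2)
        (Units.map (N := AdeleRing (𝓞 L) L) (MonoidHom.inr (InfiniteAdeleRing L) (FiniteAdeleRing (𝓞 L) L)) z) := by
  rw [← grdNu_apply, ← grdChi_comp_finAdelicCheck L ξ μω hquad hcc, MonoidHom.comp_apply]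

/-- `χ_f` is CONTINUOUS (★ p817794 `continuous_of_comp_finAdelicCheck_eq`: `u ↦ u/ū` is an open quotient map).
[cite: Bourbaki1989GeneralTopology2, Ch. IX §5] -/
theorem continuous_grdChi (ξ : OneDimAutRepH L) (μω : HeckeCharacter L)
    (hquad : ∀ x : Literature.NumberTheory.GaloisRepresentations.ideleGroup ↥(maximalRealSubfield L),
      μω (AdeleRing.ideleBaseChange (↥(maximalRealSubfield L)) L x) = quadraticHeckeCharCM L x) :
    Continuous (grdChi L ξ μω hquad) :=
  continuous_of_comp_finAdelicCheck_eq (↥(maximalRealSubfield L)) L (IsCMField.complexConj L) (complexConj_mul_complexConj' L)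
    (IsCMField.complexConj_ne_one L) (grdChi_comp_finAdelicCheck L ξ μω hquad _) (continuous_grdNu L ξ μω)

/-- `χ_f` is UNITARY when `μω` is (★ p817794 `norm_eq_one_of_comp_finAdelicCheck_eq`). [cite: Liu2021, Def. 4.11 (l. 2090)] -/
theorem norm_grdChi_apply (ξ : OneDimAutRepH L) {μω : HeckeCharacter L} (hμu : μω.IsUnitary)
    (hquad : ∀ x : Literature.NumberTheory.GaloisRepresentations.ideleGroup ↥(maximalRealSubfield L),
      μω (AdeleRing.ideleBaseChange (↥(maximalRealSubfield L)) L x) = quadraticHeckeCharCM L x)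
    (z : UnitaryGroup.finAdelicOne (↥(maximalRealSubfield L)) L (IsCMField.complexConj L)) :
    ‖((grdChi L ξ μω hquad z : ℂˣ) : ℂ)‖ = 1 :=
  norm_eq_one_of_comp_finAdelicCheck_eq (↥(maximalRealSubfield L)) L (IsCMField.complexConj L) (complexConj_mul_complexConj' L)
    (IsCMField.complexConj_ne_one L) (grdChi_comp_finAdelicCheck L ξ μω hquad _) (norm_grdNu_apply L ξ hμu) z

/-! ## §3 From the two PINS to the split identities (Dν), (Dψ) — for EVERY pair `(μ, χf)` -/

/-- **(Dν) from the semi-local pin**: `μ̃ ~ η̃⁻¹ψ̃⁻¹μω` semi-locally at `v` ⟹ `splitν₀ ξ μω w = μ̃_w` at every `w ∣ v`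
(★ p817805 locality + `localComponent_bcEtaInv_mul_bcPsiInv_mul`). [cite: Rogawski1990, Lemma 4.13.1 (b) p. 62; §12.2 (2) p. 174] -/
theorem splitNu0_eq_localComponent_of_pin (ξ : OneDimAutRepH L) (μω : HeckeCharacter L)
    (μ : Literature.NumberTheory.Automorphic.IdeleClassGroup L →ₜ* Circle)
    (v : HeightOneSpectrum (𝓞 ↥(maximalRealSubfield L)))
    (hμξ : (toHeckeCharacter L μ).semilocalComponent L v = (ξ.bcη⁻¹ * ξ.bcψ⁻¹ * μω).semilocalComponent L v)
    (w : PlacesOver L v) :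
    ξ.splitν₀ μω w.1 = (toHeckeCharacter L μ).localComponent w.1 := by
  rw [F0P2iGRDLocality.forall_localComponent_eq_of_semilocalComponent_eq L _ _ v hμξ w, localComponent_bcEtaInv_mul_bcPsiInv_mul]

/-- **(Dψ) from the two pins**: `χf(z/z̄) = (ψ̃⁻¹μ̃_ξ²)(z)` and `μ̃ ~ μ̃_ξ` semi-locally at `v` ⟹ at every `w ∣ v`,
`ψ_w = χ′_w · μ̃_w^{1-3}` with `χ′_w = χf ∘ (u ↦ u/ū) ∘ single_w` (in `ℂˣ`: `ψ̃_w⁻¹ μ̃_w² · μ̃_w⁻² = ψ̃_w⁻¹ = locψ ξ w`).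
[cite: Rogawski1990, Lemma 4.13.1 (b) p. 62; §12.2 (2) p. 174] [cite: Minguez2008, Thm. 1] -/
theorem locPsi_eq_wReading_mul_zpow_of_pins (ξ : OneDimAutRepH L) (μω : HeckeCharacter L)
    (μ : Literature.NumberTheory.Automorphic.IdeleClassGroup L →ₜ* Circle)
    (χf : UnitaryGroup.finAdelicOne (↥(maximalRealSubfield L)) L (IsCMField.complexConj L) →* ℂˣ)
    (hcc : IsCMField.complexConj L * IsCMField.complexConj L = 1)
    (hχξ : ∀ z : (FiniteAdeleRing (𝓞 L) L)ˣ,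
      χf (finAdelicCheck (↥(maximalRealSubfield L)) L (IsCMField.complexConj L) hcc z) =
        (ξ.bcψ⁻¹ * (ξ.bcη⁻¹ * ξ.bcψ⁻¹ * μω) ^ 2)
          (Units.map (N := AdeleRing (𝓞 L) L) (MonoidHom.inr (InfiniteAdeleRing L) (FiniteAdeleRing (𝓞 L) L)) z))
    (v : HeightOneSpectrum (𝓞 ↥(maximalRealSubfield L)))
    (hμξ : (toHeckeCharacter L μ).semilocalComponent L v = (ξ.bcη⁻¹ * ξ.bcψ⁻¹ * μω).semilocalComponent L v)
    (w : PlacesOver L v) :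
    ξ.locψ w.1 =
      ((χf.comp (finAdelicCheck (↥(maximalRealSubfield L)) L (IsCMField.complexConj L) hcc)).comp (Units.map (finiteAdeleSingle w.1))) *
        ((toHeckeCharacter L μ).localComponent w.1) ^ (1 - ((3 : ℕ) : ℤ)) := by
  have hloc := F0P2iGRDLocality.forall_localComponent_eq_of_semilocalComponent_eq L _ _ v hμξ w
  refine MonoidHom.ext fun a => ?_
  have hμa : (toHeckeCharacter L μ).localComponent w.1 a = (ξ.bcη⁻¹ * ξ.bcψ⁻¹ * μω) (localUnits w.1 a) := by
    rw [hloc]; rfl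
  have h3 : (1 - ((3 : ℕ) : ℤ)) = -2 := by norm_num
  rw [MonoidHom.mul_apply, MonoidHom.zpow_apply, MonoidHom.comp_apply, MonoidHom.comp_apply, hχξ, hμa, h3]
  change (ξ.bcψ.localComponent w.1 a)⁻¹ =
    (ξ.bcψ⁻¹ * (ξ.bcη⁻¹ * ξ.bcψ⁻¹ * μω) ^ 2) (localUnits w.1 a) * (ξ.bcη⁻¹ * ξ.bcψ⁻¹ * μω) (localUnits w.1 a) ^ (-2 : ℤ)
  rw [HeckeCharacter.mul_apply, HeckeCharacter.pow_apply, HeckeCharacter.inv_apply, HeckeCharacter.localComponent_apply, zpow_neg,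
    zpow_two, pow_two, mul_assoc, mul_inv_cancel, mul_one]

end Summit.HodgeConjecture.HodgeConjecture.Cruxes.H413.F0P2iGRDWitness

end
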